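import Literature.Topology.FourManifolds.ClosedBall
import Literature.Topology.FourManifolds.LinkingNumberProofs
import HarnessLib

/-!
# Surgered manifolds are compact and connected (Rolfsen §9.F)

Sibling proof file of `Literature.Topology.FourManifolds.DehnSurgery` (D-0014: named facts
`def X : Prop` are discharged by theorems `X_holds : X`, bottom-up). It discharges the two named
facts of that file on the topology of an *arbitrary* result `Y` of integral Dehn surgery on a knot
`K` in `S³` (`Literature.IsIntegralSurgery IY Y K m`: `Y` is an open gluing of the knot complement
`S³ ∖ K` and the open solid torus `D̊² × 𝕊¹` along `surgeryRel ν` for an oriented tubular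
neighbourhood `ν` of `K` of framing `m`):

* `Literature.IsIntegralSurgery.compactSpace_holds : IsIntegralSurgery.compactSpace` — `Y` is compact
  (`Literature.Topology.FourManifolds.compactSpace_of_isOpenGluing_surgeryRel`): `Y` is the union of the images of the compact
  sets `(S³ ∖ K) ∖ ν (𝕊¹ × ½D̊²)` (closed in `S³`, as the open tube `ν (𝕊¹ × ½D̊²)` contains `K`)
  and `½D̄² × 𝕊¹`, because a point `ν (u, w)` of the complement with `0 < ‖w‖ < ½` is glued to
  `(‖w‖ • u, w/‖w‖)`, of radius `< ½`, and a point `(p, v)` of the solid torus with `½ < ‖p‖`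
  to `ν (p/‖p‖, ‖p‖ • v)`, outside the tube of radius `½`;
* `Literature.IsIntegralSurgery.connectedSpace_holds : IsIntegralSurgery.connectedSpace` — `Y` is
  connected (`Literature.Topology.FourManifolds.connectedSpace_of_isOpenGluing_surgeryRel`): the knot complement is path
  connected (`Literature.Topology.FourManifolds.Knot.TubularNbhd.pathConnectedSpace_complement`, `LinkingNumberProofs.lean`),
  the open solid torus `D̊² × 𝕊¹` is connected (`Literature.Topology.FourManifolds.isConnected_solidTorus`), and their images
  meet (the point `ν (u, ½u)` is glued to `(½u, u)`).

Both are the statements, for the relational surgery predicate of the tree, of the standing remark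
of Rolfsen, *Knots and Links* (1976), §9.F that the surgered space
`(S³ ∖ ν(𝕊¹ × D̊²)) ∪_{T²} (D² × 𝕊¹)` — the union of the two compact connected pieces knot
exterior and solid torus, glued along the boundary torus — is a closed connected `3`-manifold;
Gompf–Stipsicz, *4-Manifolds and Kirby Calculus* (1999), §5.3. They hold for every open gluing
along `surgeryRel ν` (not only for a particular model of the pushout), which is what the
dependents of the two facts need: an `IsIntegralSurgery` hypothesis on an abstract `Y`.

## Sources

* D. Rolfsen, *Knots and Links*, Publish or Perish (1976), §9.F [Rolfsen1976, §9.F].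
* R. Gompf, A. Stipsicz, *4-Manifolds and Kirby Calculus*, Grad. Stud. Math. 20 (1999), §5.3
  [GompfStipsicz1999, §5.3].

Neither monograph was held by the literature store when this file was written (acquisition
requested); the statements discharged are the ones vendored (and audited) in `DehnSurgery.lean`,
and the proofs are the elementary point-set arguments above.

## Design notes

* The radial part `w ↦ w/‖w‖` of the gluing is the tree's `Literature.Topology.FourManifolds.radialProjection`
  (`ClosedBall.lean`); no definition and no notation is introduced (the plane `ℝ²` is
  `EuclideanSpace ℝ (Fin 2)`, the circle `𝕊¹` and the sphere `S³` are the unit spheres of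
  `EuclideanSpace ℝ (Fin 2)` and `EuclideanSpace ℝ (Fin 4)`, as in `DehnSurgery.lean`).
* No declaration in this file uses `sorry`; both discharges depend only on the axioms `propext`,
  `Classical.choice`, `Quot.sound`.
-/

open scoped Manifold ContDiff Topology
open Function Set Metric

noncomputable section

namespace Literature.Topology.FourManifolds

/-! ### Compactness of surgered manifolds -/

section Compact

variable {EY HY : Type*} [NormedAddCommGroup EY] [NormedSpace ℝ EY] [TopologicalSpace HY]
  {IY : ModelWithCorners ℝ EY HY} {Y : Type*} [TopologicalSpace Y] [ChartedSpace HY Y]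
  {K : Knot}

/-- **An open gluing along the surgery relation is compact** (Rolfsen (1976), §9.F): if `Y` is
glued from `S³ ∖ K` and `D̊² × 𝕊¹` along `surgeryRel ν` by `jA`, `jB`, then
`Y = jA '' C ∪ jB '' D` with `C = (S³ ∖ K) ∖ ν (𝕊¹ × ½D̊²)`, closed in `S³` (as `ν (𝕊¹ × ½D̊²)`
is open and contains `K`), and `D = ½D̄² × 𝕊¹`, both compact: a point `ν (u, w)` with
`0 < ‖w‖ < ½` is glued to `(‖w‖ • u, w/‖w‖) ∈ D`, and a point `(p, v)` with `½ < ‖p‖ < 1` to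
`ν (p/‖p‖, ‖p‖ • v) ∈ C`. [cite: Rolfsen1976, §9.F] -/
theorem compactSpace_of_isOpenGluing_surgeryRel (ν : Knot.TubularNbhd K)
    (h : IsOpenGluing (𝓡 3) (𝓘(ℝ, EuclideanSpace ℝ (Fin 2)).prod (𝓡 1)) IY (A := K.complement)
      (B := solidTorus) (P := Y) (surgeryRel ν)) : CompactSpace Y := by
  obtain ⟨jA, jB, hA, -, hB, -, hU, hR⟩ := h
  have hνo : Topology.IsOpenEmbedding ⇑ν := ⟨ν.isSmoothEmbedding_coe.isEmbedding, ν.isOpen_range⟩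
  -- the open tube of radius `1/2` and the closed piece of the complement outside it
  set U : Set (sphere (0 : EuclideanSpace ℝ (Fin 4)) 1) :=
    ν '' (univ ×ˢ ball (0 : EuclideanSpace ℝ (Fin 2)) (1 / 2)) with hUdef
  have hUo : IsOpen U := hνo.isOpenMap _ (isOpen_univ.prod isOpen_ball)
  set C : Set K.complement := Subtype.val ⁻¹' Uᶜ with hCdef
  have hC : IsCompact C := by
    rw [Subtype.isCompact_iff]
    have hCU : Subtype.val '' C = Uᶜ := by
      apply image_preimage_eq_of_subset
      intro p hp
      refine ⟨⟨p, ?_⟩, rfl⟩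
      rw [SphereEmbedding.mem_complement_iff]
      rintro ⟨y, rfl⟩
      exact hp ⟨(y, 0), ⟨mem_univ _, mem_ball_self one_half_pos⟩, ν.coe_apply_zero y⟩
    rw [hCU]
    exact hUo.isClosed_compl.isCompact
  -- the closed solid torus of radius `1/2`
  set D : Set solidTorus := {b | ‖b.1.1‖ ≤ 1 / 2} with hDdef
  have hD : IsCompact D := by
    rw [Subtype.isCompact_iff]
    have hDval : Subtype.val '' D = closedBall (0 : EuclideanSpace ℝ (Fin 2)) (1 / 2) ×ˢ univ := by
      ext p
      constructor
      · rintro ⟨b, hb, rfl⟩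
        exact ⟨mem_closedBall_zero_iff.2 hb, mem_univ _⟩
      · rintro ⟨hp, -⟩
        have hp' := mem_closedBall_zero_iff.1 hp
        exact ⟨⟨p, (mem_solidTorus_iff p).2 (hp'.trans_lt one_half_lt_one)⟩, hp', rfl⟩
    rw [hDval]
    exact (isCompact_closedBall _ _).prod isCompact_univ
  -- every point of `jA (S³ ∖ K)` lies in one of the two pieces
  have key : ∀ a : K.complement, jA a ∈ jA '' C ∪ jB '' D := by
    intro a
    by_cases ha : a ∈ C
    · exact Or.inl ⟨a, ha, rfl⟩
    · have haU : a.1 ∈ U := not_notMem.1 ha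
      obtain ⟨⟨u, w⟩, ⟨-, hw⟩, hya⟩ := haU
      have hw' : ‖w‖ < 1 / 2 := mem_ball_zero_iff.1 hw
      have hw0 : w ≠ 0 := by
        rintro rfl
        exact a.2 ⟨u, (ν.coe_apply_zero u).symm.trans hya⟩
      -- the glued point `(‖w‖ • u, w/‖w‖)` of the solid torus
      have hbmem : (‖w‖ • (u : EuclideanSpace ℝ (Fin 2)), radialProjection u w) ∈ solidTorus := by
        rw [mem_solidTorus_iff, norm_smul_coe_sphere (norm_nonneg w)]
        exact hw'.trans one_half_lt_one
      refine Or.inr ⟨⟨_, hbmem⟩, ?_, ?_⟩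
      · show ‖(‖w‖ • (u : EuclideanSpace ℝ (Fin 2)))‖ ≤ 1 / 2
        rw [norm_smul_coe_sphere (norm_nonneg w)]
        exact hw'.le
      · rw [eq_comm, hR]
        refine ⟨u, ‖w‖, ⟨norm_pos_iff.2 hw0, hw'.trans one_half_lt_one⟩, rfl, ?_⟩
        show a.1 = ν (u, ‖w‖ • (radialProjection u w : EuclideanSpace ℝ (Fin 2)))
        rw [norm_smul_coe_radialProjection, hya]
  -- the two pieces cover `Y`
  have hcov : jA '' C ∪ jB '' D = univ := by
    refine eq_univ_of_forall fun y ↦ ?_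
    have hy : y ∈ range jA ∪ range jB := by
      rw [hU]
      exact mem_univ y
    obtain ⟨a, rfl⟩ | ⟨⟨⟨p, v⟩, hpv⟩, rfl⟩ := hy
    · exact key a
    · by_cases hb : ‖p‖ ≤ 1 / 2
      · exact Or.inr ⟨⟨(p, v), hpv⟩, hb, rfl⟩
      · have hb0 : p ≠ 0 := by
          rintro rfl
          exact hb (norm_zero.trans_le one_half_pos.le)
        -- the glued point `ν (p/‖p‖, ‖p‖ • v)` of the knot complement
        have hw : ‖p‖ • (v : EuclideanSpace ℝ (Fin 2)) ≠ 0 :=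
          smul_ne_zero (norm_ne_zero_iff.2 hb0) (ne_zero_of_mem_unit_sphere _)
        have hamem : ν (radialProjection v p, ‖p‖ • (v : EuclideanSpace ℝ (Fin 2))) ∈
            K.complement := by
          rw [SphereEmbedding.mem_complement_iff]
          exact ν.apply_mem_compl_range hw
        have hp1 : ‖p‖ < 1 := (mem_solidTorus_iff (p, v)).1 hpv
        set a : K.complement := ⟨_, hamem⟩ with hadef
        have hj : jA a = jB ⟨(p, v), hpv⟩ :=
          (hR a _).2 ⟨radialProjection v p, ‖p‖, ⟨norm_pos_iff.2 hb0, hp1⟩,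
            (norm_smul_coe_radialProjection v p).symm, rfl⟩
        rw [← hj]
        exact key a
  refine ⟨?_⟩
  rw [← hcov]
  exact (hC.image hA.isEmbedding.continuous).union (hD.image hB.isEmbedding.continuous)

/-- **A surgered manifold is compact** — discharge of the named fact
`Literature.Topology.FourManifolds.IsIntegralSurgery.compactSpace` of `DehnSurgery.lean` (Rolfsen (1976), §9.F): `Y` is the
union of the images of the compact sets `(S³ ∖ K) ∖ ν (𝕊¹ × ½D̊²)` and `½D̄² × 𝕊¹`
(`compactSpace_of_isOpenGluing_surgeryRel`). [cite: Rolfsen1976, §9.F] -/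
theorem IsIntegralSurgery.compactSpace_holds :
    IsIntegralSurgery.compactSpace (IY := IY) (Y := Y) := by
  intro K m h
  obtain ⟨ν, -, hG⟩ := h
  exact compactSpace_of_isOpenGluing_surgeryRel ν hG

end Compact

/-! ### Connectedness of surgered manifolds -/

section Connected

variable {EY HY : Type*} [NormedAddCommGroup EY] [NormedSpace ℝ EY] [TopologicalSpace HY]
  {IY : ModelWithCorners ℝ EY HY} {Y : Type*} [TopologicalSpace Y] [ChartedSpace HY Y]
  {K : Knot}

/-- The circle `𝕊¹` is connected. [folklore] -/
theorem connectedSpace_sphereOne : ConnectedSpace (sphere (0 : EuclideanSpace ℝ (Fin 2)) 1) :=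
  isConnected_iff_connectedSpace.1
    (isConnected_sphere (one_lt_rank_euclideanSpace one_lt_two) (0 : EuclideanSpace ℝ (Fin 2))
      zero_le_one)

/-- **The open solid torus `D̊² × 𝕊¹` is connected** (a product of the convex unit disc and the
circle). [folklore] -/
theorem isConnected_solidTorus :
    IsConnected
      (solidTorus : Set (EuclideanSpace ℝ (Fin 2) × sphere (0 : EuclideanSpace ℝ (Fin 2)) 1)) := by
  haveI := connectedSpace_sphereOne
  have h1 : IsConnected (ball (0 : EuclideanSpace ℝ (Fin 2)) 1) :=
    ⟨⟨0, mem_ball_self one_pos⟩, (convex_ball (0 : EuclideanSpace ℝ (Fin 2)) 1).isPreconnected⟩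
  show IsConnected (ball (0 : EuclideanSpace ℝ (Fin 2)) 1 ×ˢ univ)
  exact h1.prod isConnected_univ

/-- The open solid torus is a connected space. [folklore] -/
theorem connectedSpace_solidTorus : ConnectedSpace solidTorus :=
  isConnected_iff_connectedSpace.1 isConnected_solidTorus

/-- **An open gluing along the surgery relation is connected** (Rolfsen (1976), §9.F): `Y` is the
union of the images of the connected pieces `S³ ∖ K`
(`Knot.TubularNbhd.pathConnectedSpace_complement`) and `D̊² × 𝕊¹` (`isConnected_solidTorus`),
which meet: the point `ν (u, ½u)` of the complement is glued to `(½u, u)`.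
[cite: Rolfsen1976, §9.F] -/
theorem connectedSpace_of_isOpenGluing_surgeryRel (ν : Knot.TubularNbhd K)
    (h : IsOpenGluing (𝓡 3) (𝓘(ℝ, EuclideanSpace ℝ (Fin 2)).prod (𝓡 1)) IY (A := K.complement)
      (B := solidTorus) (P := Y) (surgeryRel ν)) : ConnectedSpace Y := by
  obtain ⟨jA, jB, hA, -, hB, -, hU, hR⟩ := h
  haveI : PathConnectedSpace K.complement := Knot.TubularNbhd.pathConnectedSpace_complement ν
  haveI : ConnectedSpace solidTorus := connectedSpace_solidTorus
  have hAc : IsConnected (range jA) := isConnected_range hA.isEmbedding.continuous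
  have hBc : IsConnected (range jB) := isConnected_range hB.isEmbedding.continuous
  -- a common point of the two images
  set u : sphere (0 : EuclideanSpace ℝ (Fin 2)) 1 := circlePoint 0 with hu
  have ha : ν (u, (1 / 2 : ℝ) • (u : EuclideanSpace ℝ (Fin 2))) ∈ K.complement := by
    rw [SphereEmbedding.mem_complement_iff]
    exact ν.apply_mem_compl_range (half_smul_coe_sphere_ne_zero u)
  have hb : ((1 / 2 : ℝ) • (u : EuclideanSpace ℝ (Fin 2)), u) ∈ solidTorus := by
    rw [mem_solidTorus_iff, norm_smul, norm_eq_of_mem_sphere, mul_one]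
    norm_num
  set a : K.complement := ⟨_, ha⟩ with hadef
  set b : solidTorus := ⟨_, hb⟩ with hbdef
  have hj : jA a = jB b := (hR a b).2 ⟨u, 1 / 2, ⟨one_half_pos, one_half_lt_one⟩, rfl, rfl⟩
  have hne : (range jA ∩ range jB).Nonempty := ⟨jA a, ⟨a, rfl⟩, ⟨b, hj.symm⟩⟩
  rw [connectedSpace_iff_univ, ← hU]
  exact hAc.union hne hBc

/-- **A surgered manifold is connected** — discharge of the named fact
`Literature.Topology.FourManifolds.IsIntegralSurgery.connectedSpace` of `DehnSurgery.lean` (Rolfsen (1976), §9.F): the knot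
complement and the solid torus are connected and their images meet
(`connectedSpace_of_isOpenGluing_surgeryRel`). [cite: Rolfsen1976, §9.F] -/
theorem IsIntegralSurgery.connectedSpace_holds :
    IsIntegralSurgery.connectedSpace (IY := IY) (Y := Y) := by
  intro K m h
  obtain ⟨ν, -, hG⟩ := h
  exact connectedSpace_of_isOpenGluing_surgeryRel ν hG

end Connected

end Literature.Topology.FourManifolds
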